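import Summits.Schanuel.Schanuel.Theorems.DiophantineDichotomyDefs
import Summits.Schanuel.Schanuel.Theorems.DiophantineDichotomyKhovanskiiApproxTypeSiegelInIdeal
import Summits.Schanuel.Schanuel.Theorems.DiophantineDichotomyKhovanskiiApproxTypeTransferOfSiegel
import Summits.Schanuel.Schanuel.Theorems.DiophantineDichotomyKhovanskiiApproxTypeSlotDichotomyTwo

/-!
# Line `lw-small-height` for crux `KhovanskiiApproxType` (stmt-Schanuel-6116): the composition

Route `DiophantineDichotomy`, crux `Summit.Schanuel.Schanuel.Theses.DiophantineDichotomy.KhovanskiiApproxType`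
(measure of simultaneous algebraic approximation `‖γ − θ‖ ≥ exp(−C(dᵃ log H + dᵇ))`, `a < 1/(n−1)`, at
every free Khovanskii point `θ = (s, e^s) ∈ ℂ²ⁿ`, `n ≥ 2`).  This file is the SORRY-FREE part of the
registered skeleton `Cruxes/KhovanskiiApproxType/Lines/lw-small-height.lean` (v3, line lead
`prover-line-stmt-Schanuel-6116-r-0`) after wave 1 of the line landed its provable spine:

* `stub_siegelInIdeal : SiegelInIdeal` (relative Siegel lemma inside the ideal of the challenger, by the
  box principle in one complex embedding + the archimedean Liouville inequality; module
  `…KhovanskiiApproxTypeSiegelInIdeal`, p76390),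
* `stub_transferOfSiegel : SiegelInIdeal → CodimOneTransfer` (Mahler–Weil heights of the slots, `C⁺` at
  the Siegel relation, mean value; module `…KhovanskiiApproxTypeTransferOfSiegel`, p76504),
* `stub_slotDichotomy_two : SlotDichotomyTwo` (the `n = 2` slot dichotomy `a = A·p/(A+1)`; module
  `…KhovanskiiApproxTypeSlotDichotomyTwo`, p75181).

Proved here (no `sorry`, no new definitions):
* `codimOneTransfer_holds : CodimOneTransfer` — UNCONDITIONAL: a decoupled codimension-one measure with
  exponents `(μ, K)` at `ω ∈ ℂᵐ` gives the primitive approximation measure with `p = (μ+1)/m`,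
  `q = (max μ K + 1)/m + 1`;
* `approxTypeAt_two_of_inputs` — at any `s ∈ ℂ²`: `C⁺ (μ)` at a pair of coordinates of `θ = (s, e^s)`
  plus floors `(A)` at both, in the race window `A(μ+1) < 2(A+1)`, give approximation type `a < 1`;
* `approxTypeAt_two_of_LW` — the LINDEMANN–WEIERSTRASS LAYER of the crux CONDITIONALLY: for
  `s ∈ ℚ̄²` with `ℚ`-linearly independent coordinates, `LWSmallHeight 1 → LWSmallHeight 2 →
  ∃ a < 1, ApproxTypeAt 2 s a b C` (the two hypotheses are the line's OPEN stubs: all-height,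
  degree-optimal Lindemann–Weierstrass measures with polynomial small-height penalty; in print only with
  penalty `exp(C D^m log(D+1))`, Ably 1994);
* `khovanskiiApproxType_of_parts` — the crux from the four open inputs
  `LWSmallHeight 1`, `LWSmallHeight 2`, `NonLWInputsTwo` (Schanuel-strength at the non-LW `n = 2`
  points), `RankThreeUp` (= the crux for `n ≥ 3`); registered on stmt-Schanuel-6116 as the sub-goal stub
  of the same name (the closing skeleton v4 is this implication applied to the four open stubs).

Nothing here closes stmt-Schanuel-6116 (an open Diophantine conjecture); the file records exactly which
inputs the typed crux has been reduced to on this line.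
-/

noncomputable section

-- `Summit.Schanuel.Schanuel.…` is the mandated summit/sub-problem namespace (single-conjunct summit), hence:
set_option linter.dupNamespace false

open scoped BigOperators

namespace Summit.Schanuel.Schanuel.Cruxes.KhovanskiiApproxType.LwSmallHeight

open Summit.Schanuel.Schanuel.Theses.DiophantineDichotomy (KhovanskiiApproxType)

/-- **The transfer is a theorem** (wave 1 of line `lw-small-height`): `CodimOneTransfer` — a decoupled
codimension-one measure `(μ, K)` at `ω ∈ ℂᵐ` gives the primitive approximation measure with
`p = (μ+1)/m`, `q = (max μ K + 1)/m + 1` — from the landed halves `stub_siegelInIdeal` (relative Siegel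
lemma) and `stub_transferOfSiegel` (Mahler–Weil heights + mean value). -/
theorem codimOneTransfer_holds : CodimOneTransfer :=
  stub_transferOfSiegel stub_siegelInIdeal

/-- **The `n = 2` composition from native inputs**: at `θ = (s, e^s) ∈ ℂ⁴`, a decoupled codimension-one
measure with exponents `(μ, K)` at a pair `e` of coordinates together with floors of degree exponent
`A > 0` at both coordinates of the pair, in the race window `A(μ+1) < 2(A+1)`, give approximation type
`a < 1` (`a = A·p/(A+1)` with `p = (μ+1)/2`, by `codimOneTransfer_holds` and
`stub_slotDichotomy_two`). -/
theorem approxTypeAt_two_of_inputs (s : Fin 2 → ℂ) (e : Fin 2 → Fin 2 ⊕ Fin 2)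
    (he : Function.Injective e) (μ K C A : ℝ) (hμ : 0 ≤ μ) (hK : 0 ≤ K) (hA : 0 < A)
    (hrace : A * (μ + 1) < 2 * (A + 1))
    (hC : CodimOneMeasure 2 (Sum.elim s (Complex.exp ∘ s) ∘ e) μ K C)
    (hfl : ∀ i, ∃ K₁ C₁ : ℝ, SlotFloor (Sum.elim s (Complex.exp ∘ s) (e i)) A K₁ C₁) :
    ∃ a b C' : ℝ, a < 1 ∧ ApproxTypeAt 2 s a b C' := by
  obtain ⟨C', hP⟩ := codimOneTransfer_holds 2 _ μ K C (by norm_num) hμ hK hC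
  have hp : (0 : ℝ) ≤ (μ + 1) / (2 : ℕ) := by positivity
  have hrace' : A * ((μ + 1) / (2 : ℕ)) < A + 1 := by
    push_cast
    nlinarith [hrace, hA]
  exact stub_slotDichotomy_two s e _ _ C' A he hp hA hrace' hP hfl

/-- **The Lindemann–Weierstrass layer of the crux, conditionally** (the idea card's first lemma, now a
kernel-checked implication): at `s ∈ ℚ̄²` with `ℚ`-linearly independent coordinates, the two OPEN
small-height Lindemann–Weierstrass measures — `LWSmallHeight 2` = `C⁺` with `μ = 2` at the pair of
`y`-slots `(e^{s₁}, e^{s₂})`, `LWSmallHeight 1` = the floors with `A = 1` there — give approximation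
type `a < 1` (the bookkeeping gives `a = 3/4`).  CONDITIONAL: both hypotheses are unproved (printed only
with an exponential small-height penalty, Ably 1994). -/
theorem approxTypeAt_two_of_LW (h₁ : LWSmallHeight 1) (h₂ : LWSmallHeight 2) (s : Fin 2 → ℂ)
    (halg : ∀ i, IsAlgebraic ℚ (s i)) (hli : LinearIndependent ℚ s) :
    ∃ a b C : ℝ, a < 1 ∧ ApproxTypeAt 2 s a b C := by
  -- `C⁺` on the LW layer: the two-variable small-height LW measure at `(e^{s₁}, e^{s₂})`
  obtain ⟨K, C, hK, hC⟩ := h₂ s halg hli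
  -- the floors at the two `y`-slots: the one-variable small-height LW measure at `e^{s i}`
  have hfloors : ∀ i : Fin 2, ∃ K₁ C₁ : ℝ,
      SlotFloor (Sum.elim s (Complex.exp ∘ s) (Sum.inr i)) ((1 : ℕ) : ℝ) K₁ C₁ := by
    intro i
    have hli1 : LinearIndependent ℚ (fun _ : Fin 1 => s i) :=
      linearIndependent_unique_iff.2 (hli.ne_zero i)
    obtain ⟨K₁, C₁, -, h⟩ := h₁ (fun _ => s i) (fun _ => halg i) hli1
    exact ⟨K₁, C₁, h⟩
  -- race window with `μ = 2`, `A = 1`: `1·(2+1) = 3 < 4 = 2(1+1)`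
  exact approxTypeAt_two_of_inputs s Sum.inr Sum.inr_injective ((2 : ℕ) : ℝ) K C ((1 : ℕ) : ℝ)
    (by positivity) hK (by norm_num) (by norm_num) hC hfloors

/-- **What the typed crux has been reduced to on this line**: `KhovanskiiApproxType` follows from the
four OPEN inputs — the two small-height LW measures (LW layer of `n = 2`), `NonLWInputsTwo` (`C⁺` +
floors at the non-LW `n = 2` free Khovanskii points; Schanuel-strength pointwise, e.g. it contains
`e ⊥ π` with a measure at `s = (1, iπ)`), and `RankThreeUp` (the crux verbatim for `n ≥ 3`).  The spine
(transfer + slot dichotomy) is unconditional. -/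
theorem khovanskiiApproxType_of_parts :
    LWSmallHeight 1 → LWSmallHeight 2 → NonLWInputsTwo → RankThreeUp →
      Summit.Schanuel.Schanuel.Theses.DiophantineDichotomy.KhovanskiiApproxType := by
  intro h₁ h₂ hN hR
  rw [khovanskiiApproxType_iff]
  intro n s hn hli hfree
  by_cases h3 : 3 ≤ n
  · exact hR n s h3 hli hfree
  obtain rfl : n = 2 := by omega
  have key : ∃ a b C : ℝ, a < 1 ∧ ApproxTypeAt 2 s a b C := by
    by_cases halg : ∀ i, IsAlgebraic ℚ (s i)
    · exact approxTypeAt_two_of_LW h₁ h₂ s halg hli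
    · push Not at halg
      obtain ⟨i, hi⟩ := halg
      obtain ⟨e, he, μ, K, C, A, hμ, hK, hA, hrace, hC, hfl⟩ := hN s hli hfree ⟨i, hi⟩
      exact approxTypeAt_two_of_inputs s e he μ K C A hμ hK hA hrace hC hfl
  obtain ⟨a, b, C, ha, hat⟩ := key
  refine ⟨a, b, C, ?_, hat⟩
  have h1 : (1 : ℝ) / (((2 : ℕ) : ℝ) - 1) = 1 := by norm_num
  rw [h1]
  exact ha

end Summit.Schanuel.Schanuel.Cruxes.KhovanskiiApproxType.LwSmallHeight

end
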